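import Mathlib
import Summits.NavierStokesRegularity.NavierStokesRegularity.Theorems.FilamentSkeletonRssDefectColumnGateRadialField
import Summits.NavierStokesRegularity.NavierStokesRegularity.Theorems.FilamentSkeletonRssDefectColumnGateQuasimodeWitness

/-!
# Route `FilamentSkeletonRss` · crux `TransverseReduction1AG` (stmt-NavierStokesRegularity-27853) · line `defect_column_gate_1AG` —
# the S2a operator on the ROTATED DIPOLE sector `Ψ = y₁ χ(y₀² + y₁²)` of the symmetric column, in closed form (companion of `…DipoleSector.lean`)

Helper file (theorems only, `--supports stmt-NavierStokesRegularity-23297 --as helper`; LEAD of 23297 (L-twin of the aside 27853), lane ns-filament-21221-p1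
g11).  The second real component of the m = 1 sector of the localised sectional waist gate S2a-loc `WaistColumnGateLoc1A` (clause-free; the same stub on
27853 and 23297): for `Ψ(y) = y₁ χ(q)`, `q = y₀² + y₁²`, `χ ∈ C⁴`, `W = ∇Ψ × e₃ = (χ + 2y₁²χ′, −2y₀y₁χ′, 0)` (`streamField_dip11`), `curl W = y₁ h(q) e₃` with
`h = −(4qχ″ + 8χ′)` (`laplacian_dip11`), and for the frozen waist column with symmetric sectional strain `B = diag(−γ/2, −γ/2, 3/2+γ)`, any `α`, any `Rc`:
`colForceVort B α γ Rc e₃ W (y) = ( y₁·[−(4q h″ + 8 h′ + γ q h′ + (3γ/2) h)](q) + y₀·[c(q) h(q) − (γ/2) ζ(q) χ(q)] )·e₃`  (`colForceVort_dip11`) — the mirror of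
`colForceVort_dip1` (p664237) with the cross terms' signs flipped, as the column rotates `e₀ → e₁ → −e₀`.  Together the two files give the whole real
m = 1 sector `Ψ = y₀φ(q) + y₁χ(q)` (the complex structure `Φ = φ + iχ`: rotation and Biot–Savart reaction act as `−i(c·G − (γ/2)ζ·Φ)`).  HONEST FRAMING:
calculus identities about the MODEL operator of a hypothetical blow-up route (MODEL rung, negative side); no stub is proved or refuted here; nothing here
bears on Navier–Stokes regularity.
-/

set_option linter.dupNamespace false

noncomputable section

namespace Summit.NavierStokesRegularity.NavierStokesRegularity.Theorems.DefectColumnGate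

open scoped BigOperators Topology InnerProductSpace Laplacian ContDiff
open Set Function
open Literature.Analysis.FluidPDE
open Summit.NavierStokesRegularity.NavierStokesRegularity.Theorems.KelvinGate

/-! ## 1. Calculus of the rotated dipole scalar `y ↦ y₁ χ(y₀² + y₁²)` (written `φ` below) -/

/-- `D(y₁φ(q))(y) = φ(q)·pr₁ + y₁φ′(q)·(2y₀·pr₀ + 2y₁·pr₁)`. -/
theorem hasFDerivAt_dip1 {φ : ℝ → ℝ} {φ' : ℝ} {y : EuclideanSpace ℝ (Fin 3)} (hφ : HasDerivAt φ φ' (y 0 ^ 2 + y 1 ^ 2)) :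
    HasFDerivAt (fun y : EuclideanSpace ℝ (Fin 3) => y 1 * φ (y 0 ^ 2 + y 1 ^ 2))
      (φ (y 0 ^ 2 + y 1 ^ 2) • (EuclideanSpace.proj (1 : Fin 3) : EuclideanSpace ℝ (Fin 3) →L[ℝ] ℝ) +
        (y 1 * φ') • ((2 * y 0) • (EuclideanSpace.proj (0 : Fin 3) : EuclideanSpace ℝ (Fin 3) →L[ℝ] ℝ) +
          (2 * y 1) • (EuclideanSpace.proj (1 : Fin 3) : EuclideanSpace ℝ (Fin 3) →L[ℝ] ℝ))) y := by
  have h0 := (EuclideanSpace.proj (𝕜 := ℝ) (1 : Fin 3)).hasFDerivAt (x := y)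
  have h := h0.mul (hasFDerivAt_rad hφ)
  refine h.congr_fderiv ?_
  have hp : ∀ (i : Fin 3) (z : EuclideanSpace ℝ (Fin 3)), (EuclideanSpace.proj i : EuclideanSpace ℝ (Fin 3) →L[ℝ] ℝ) z = z i :=
    fun _ _ => rfl
  ext v
  simp only [_root_.add_apply, _root_.smul_apply, smul_eq_mul, hp]
  ring

/-- Applied form: `D(y₁φ(q))(y)[v] = φ(q)v₁ + y₁φ′(q)(2y₀v₀ + 2y₁v₁)`. -/
theorem fderiv_dip1_apply {φ : ℝ → ℝ} {φ' : ℝ} {y : EuclideanSpace ℝ (Fin 3)} (hφ : HasDerivAt φ φ' (y 0 ^ 2 + y 1 ^ 2))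
    (v : EuclideanSpace ℝ (Fin 3)) :
    fderiv ℝ (fun y : EuclideanSpace ℝ (Fin 3) => y 1 * φ (y 0 ^ 2 + y 1 ^ 2)) y v =
      φ (y 0 ^ 2 + y 1 ^ 2) * v 1 + y 1 * φ' * (2 * y 0 * v 0 + 2 * y 1 * v 1) := by
  rw [(hasFDerivAt_dip1 hφ).fderiv]
  have hp : ∀ (i : Fin 3) (z : EuclideanSpace ℝ (Fin 3)), (EuclideanSpace.proj i : EuclideanSpace ℝ (Fin 3) →L[ℝ] ℝ) z = z i :=
    fun _ _ => rfl
  simp only [_root_.add_apply, _root_.smul_apply, smul_eq_mul, hp]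

/-- `y₁φ(q) ∈ Cⁿ` for `φ ∈ Cⁿ`. -/
theorem contDiff_dip1 {φ : ℝ → ℝ} {n : WithTop ℕ∞} (hφ : ContDiff ℝ n φ) :
    ContDiff ℝ n (fun y : EuclideanSpace ℝ (Fin 3) => y 1 * φ (y 0 ^ 2 + y 1 ^ 2)) :=
  (EuclideanSpace.proj (𝕜 := ℝ) (1 : Fin 3)).contDiff.mul (contDiff_rad hφ)

/-- Axial constancy: `D(y₁φ(q))(y)[e₃] = 0`. -/
theorem fderiv_dip1_axis {φ : ℝ → ℝ} (hφ : Differentiable ℝ φ) (y : EuclideanSpace ℝ (Fin 3)) :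
    fderiv ℝ (fun y : EuclideanSpace ℝ (Fin 3) => y 1 * φ (y 0 ^ 2 + y 1 ^ 2)) y (EuclideanSpace.single 2 1) = 0 := by
  rw [fderiv_dip1_apply (hφ _).hasDerivAt]
  simp

/-- The gradient: `∇(y₁φ(q)) = 2y₀y₁φ′·e₀ + (φ + 2y₁²φ′)·e₁`. -/
theorem gradient_dip1 {φ : ℝ → ℝ} {φ' : ℝ} {y : EuclideanSpace ℝ (Fin 3)} (hφ : HasDerivAt φ φ' (y 0 ^ 2 + y 1 ^ 2)) :
    gradient (fun y : EuclideanSpace ℝ (Fin 3) => y 1 * φ (y 0 ^ 2 + y 1 ^ 2)) y =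
      (2 * y 0 * y 1 * φ') • EuclideanSpace.single 0 1 + (φ (y 0 ^ 2 + y 1 ^ 2) + 2 * y 1 ^ 2 * φ') • EuclideanSpace.single 1 1 := by
  refine ext_inner_right ℝ fun v => ?_
  rw [Literature.Analysis.FluidPDE.inner_gradient_left, fderiv_dip1_apply hφ v, inner_add_left, real_inner_smul_left, real_inner_smul_left,
    EuclideanSpace.inner_single_left, EuclideanSpace.inner_single_left]
  simp; ring

/-- The rotated dipole stream field: `∇(y₁φ(q)) × e₃ = (φ + 2y₁²φ′)·e₀ − 2y₀y₁φ′·e₁`. -/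
theorem streamField_dip1 {φ : ℝ → ℝ} {φ' : ℝ} {y : EuclideanSpace ℝ (Fin 3)} (hφ : HasDerivAt φ φ' (y 0 ^ 2 + y 1 ^ 2)) :
    cross (gradient (fun y : EuclideanSpace ℝ (Fin 3) => y 1 * φ (y 0 ^ 2 + y 1 ^ 2)) y) (EuclideanSpace.single 2 1) =
      (φ (y 0 ^ 2 + y 1 ^ 2) + 2 * y 1 ^ 2 * φ') • EuclideanSpace.single 0 1 - (2 * y 0 * y 1 * φ') • EuclideanSpace.single 1 1 := by
  rw [gradient_dip1 hφ]
  ext i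
  fin_cases i <;> simp [cross, crossProduct, Matrix.cons_val_zero, Matrix.cons_val_one]

/-! ## 2. The Laplacian of the dipole scalar -/

/-- `Δ(y₁φ(q))(y) = y₁·(4q φ″(q) + 8 φ′(q))` for `φ ∈ C²`. -/
theorem laplacian_dip1 {φ : ℝ → ℝ} (hφ : ContDiff ℝ 2 φ) (y : EuclideanSpace ℝ (Fin 3)) :
    (Δ (fun y : EuclideanSpace ℝ (Fin 3) => y 1 * φ (y 0 ^ 2 + y 1 ^ 2))) y =
      y 1 * (4 * (y 0 ^ 2 + y 1 ^ 2) * deriv (deriv φ) (y 0 ^ 2 + y 1 ^ 2) + 8 * deriv φ (y 0 ^ 2 + y 1 ^ 2)) := by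
  have hφ1 : Differentiable ℝ φ := hφ.differentiable (by norm_num)
  have hdφ : ContDiff ℝ 1 (deriv φ) := by
    have := hφ.iterate_deriv' 1 1; simpa using this
  have hdφ1 : Differentiable ℝ (deriv φ) := hdφ.differentiable (by norm_num)
  set P0 : EuclideanSpace ℝ (Fin 3) →L[ℝ] ℝ := EuclideanSpace.proj (0 : Fin 3) with hP0
  set P1 : EuclideanSpace ℝ (Fin 3) →L[ℝ] ℝ := EuclideanSpace.proj (1 : Fin 3) with hP1
  have hp : ∀ (i : Fin 3) (z : EuclideanSpace ℝ (Fin 3)), (EuclideanSpace.proj i : EuclideanSpace ℝ (Fin 3) →L[ℝ] ℝ) z = z i :=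
    fun _ _ => rfl
  -- the first derivative as a function: `DΨ(z) = (2z₀z₁φ′(q))·P0 + (φ(q) + 2z₁²φ′(q))·P1`
  have hD1 : fderiv ℝ (fun y : EuclideanSpace ℝ (Fin 3) => y 1 * φ (y 0 ^ 2 + y 1 ^ 2)) =
      fun z => (2 * z 0 * z 1 * deriv φ (z 0 ^ 2 + z 1 ^ 2)) • P0
        + (φ (z 0 ^ 2 + z 1 ^ 2) + 2 * z 1 ^ 2 * deriv φ (z 0 ^ 2 + z 1 ^ 2)) • P1 := by
    funext z
    rw [(hasFDerivAt_dip1 (hφ1 _).hasDerivAt).fderiv, smul_add, smul_smul, smul_smul]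
    have e : ∀ (a b c : ℝ), a • P1 + (b • P0 + c • P1) = b • P0 + (a + c) • P1 := fun a b c => by
      rw [add_smul]; abel
    rw [e]
    congr 1 <;> congr 1 <;> ring
  -- derivatives of the two coefficient functions at `y`
  have hcφ : HasFDerivAt (fun z : EuclideanSpace ℝ (Fin 3) => φ (z 0 ^ 2 + z 1 ^ 2))
      (deriv φ (y 0 ^ 2 + y 1 ^ 2) • ((2 * y 0) • P0 + (2 * y 1) • P1)) y := hasFDerivAt_rad (hφ1 _).hasDerivAt
  have hcφ' : HasFDerivAt (fun z : EuclideanSpace ℝ (Fin 3) => deriv φ (z 0 ^ 2 + z 1 ^ 2))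
      (deriv (deriv φ) (y 0 ^ 2 + y 1 ^ 2) • ((2 * y 0) • P0 + (2 * y 1) • P1)) y := hasFDerivAt_rad (hdφ1 _).hasDerivAt
  have h0 := P0.hasFDerivAt (x := y)
  have h1 := P1.hasFDerivAt (x := y)
  have hz1 : HasFDerivAt (fun z : EuclideanSpace ℝ (Fin 3) => z 1 ^ 2) ((2 * y 1) • P1) y := by
    have h := h1.mul h1
    have hfun : (fun z : EuclideanSpace ℝ (Fin 3) => z 1 ^ 2) = fun z => P1 z * P1 z := by
      funext z; rw [hP1, hp]; ring
    rw [hfun]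
    refine h.congr_fderiv ?_
    ext v
    simp only [hP1, hp, _root_.add_apply, _root_.smul_apply, smul_eq_mul]
    ring
  have ha : HasFDerivAt (fun z : EuclideanSpace ℝ (Fin 3) => 2 * z 0 * z 1 * deriv φ (z 0 ^ 2 + z 1 ^ 2))
      ((2 * y 1 * deriv φ (y 0 ^ 2 + y 1 ^ 2)) • P0 + (2 * y 0 * deriv φ (y 0 ^ 2 + y 1 ^ 2)) • P1
        + (2 * y 0 * y 1) • (deriv (deriv φ) (y 0 ^ 2 + y 1 ^ 2) • ((2 * y 0) • P0 + (2 * y 1) • P1))) y := by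
    have h := (((h0.const_mul (2:ℝ)).mul h1).mul hcφ')
    refine h.congr_fderiv ?_
    ext v
    simp only [hP0, hP1, hp, _root_.add_apply, _root_.smul_apply, smul_eq_mul, Pi.mul_apply]
    ring
  have hb : HasFDerivAt (fun z : EuclideanSpace ℝ (Fin 3) => φ (z 0 ^ 2 + z 1 ^ 2) + 2 * z 1 ^ 2 * deriv φ (z 0 ^ 2 + z 1 ^ 2))
      (deriv φ (y 0 ^ 2 + y 1 ^ 2) • ((2 * y 0) • P0 + (2 * y 1) • P1)
        + ((4 * y 1 * deriv φ (y 0 ^ 2 + y 1 ^ 2)) • P1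
          + (2 * y 1 ^ 2) • (deriv (deriv φ) (y 0 ^ 2 + y 1 ^ 2) • ((2 * y 0) • P0 + (2 * y 1) • P1)))) y := by
    have h := hcφ.add ((hz1.const_mul (2:ℝ)).mul hcφ')
    refine h.congr_fderiv ?_
    ext v
    simp only [hP0, hP1, hp, _root_.add_apply, _root_.smul_apply, smul_eq_mul]
    ring
  have hD2 : HasFDerivAt (fderiv ℝ (fun y : EuclideanSpace ℝ (Fin 3) => y 1 * φ (y 0 ^ 2 + y 1 ^ 2)))
      (((2 * y 1 * deriv φ (y 0 ^ 2 + y 1 ^ 2)) • P0 + (2 * y 0 * deriv φ (y 0 ^ 2 + y 1 ^ 2)) • P1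
        + (2 * y 0 * y 1) • (deriv (deriv φ) (y 0 ^ 2 + y 1 ^ 2) • ((2 * y 0) • P0 + (2 * y 1) • P1))).smulRight P0 +
        (deriv φ (y 0 ^ 2 + y 1 ^ 2) • ((2 * y 0) • P0 + (2 * y 1) • P1)
          + ((4 * y 1 * deriv φ (y 0 ^ 2 + y 1 ^ 2)) • P1
            + (2 * y 1 ^ 2) • (deriv (deriv φ) (y 0 ^ 2 + y 1 ^ 2) • ((2 * y 0) • P0 + (2 * y 1) • P1)))).smulRight P1) y := by
    rw [hD1]
    exact (ha.smul_const P0).add (hb.smul_const P1)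
  rw [KelvinGate.laplacian_eq_sum_fderiv_fderiv]
  simp only
  rw [hD2.fderiv]
  simp [Fin.sum_univ_three, hP0, hP1, ContinuousLinearMap.smulRight_apply]
  ring

/-! ## 3. The S2a operator on the rotated dipole sector -/

/-- **THE S2a OPERATOR ON THE ROTATED DIPOLE SECTOR (symmetric sectional strain).**  `B = diag(−γ/2, −γ/2, 3/2+γ)`, any `α`, any `Rc`,
`Ψ(y) = y₁φ(q)` with `φ ∈ C⁴`, `W = ∇Ψ × e₃`, `g(u) := −(4uφ″(u) + 8φ′(u))` (so `curl W = y₁ g(q) e₃`):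
`colForceVort B α γ Rc e₃ W (y) = (y₁·[−(4q g″ + 8g′ + γ q g′ + (3γ/2) g)](q) + y₀·[c(q)g(q) − (γ/2)ζ(q)φ(q)])·e₃`,
`c(q) = (γRc/8π)·burgersPhi(γq/4)`, `ζ(q) = (γRc/4π)·e^{−γq/4}`, `q = y₀² + y₁²`. -/
theorem colForceVort_dip1 {φ : ℝ → ℝ} (hφ : ContDiff ℝ 4 φ)
    {B : EuclideanSpace ℝ (Fin 3) →L[ℝ] EuclideanSpace ℝ (Fin 3)} {γ α Rc : ℝ}
    (hB0 : B (EuclideanSpace.single 0 1) = (-(γ / 2)) • EuclideanSpace.single 0 1)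
    (hB1 : B (EuclideanSpace.single 1 1) = (-(γ / 2)) • EuclideanSpace.single 1 1)
    (hB2 : B (EuclideanSpace.single 2 1) = (3 / 2 + γ) • EuclideanSpace.single 2 1)
    (g : ℝ → ℝ) (hg : ∀ u, g u = -(4 * u * deriv (deriv φ) u + 8 * deriv φ u)) (y : EuclideanSpace ℝ (Fin 3)) :
    colForceVort B α γ Rc (EuclideanSpace.single 2 1)
        (fun z => cross (gradient (fun y : EuclideanSpace ℝ (Fin 3) => y 1 * φ (y 0 ^ 2 + y 1 ^ 2)) z) (EuclideanSpace.single 2 1)) y =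
      ( y 1 * (-(4 * (y 0 ^ 2 + y 1 ^ 2) * deriv (deriv g) (y 0 ^ 2 + y 1 ^ 2) + 8 * deriv g (y 0 ^ 2 + y 1 ^ 2)
            + γ * (y 0 ^ 2 + y 1 ^ 2) * deriv g (y 0 ^ 2 + y 1 ^ 2) + (3 * γ / 2) * g (y 0 ^ 2 + y 1 ^ 2)))
        + y 0 * ((γ * Rc / (8 * Real.pi) * burgersPhi (γ * (y 0 ^ 2 + y 1 ^ 2) / 4)) * g (y 0 ^ 2 + y 1 ^ 2)
            - (γ / 2) * (γ * Rc / (4 * Real.pi) * Real.exp (-(γ * (y 0 ^ 2 + y 1 ^ 2) / 4))) * φ (y 0 ^ 2 + y 1 ^ 2)) )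
        • EuclideanSpace.single 2 1 := by
  -- regularity bookkeeping
  have hφ2 : ContDiff ℝ 2 φ := hφ.of_le (by norm_num)
  have hφ1 : Differentiable ℝ φ := hφ.differentiable (by norm_num)
  have hd1 : ContDiff ℝ 3 (deriv φ) := by
    have := hφ.iterate_deriv' 3 1; simpa using this
  have hd2 : ContDiff ℝ 2 (deriv (deriv φ)) := by
    have := hφ.iterate_deriv' 2 2; simpa using this
  have hgfun : g = fun u => -(4 * u * deriv (deriv φ) u + 8 * deriv φ u) := funext hg
  have hgC : ContDiff ℝ 2 g := by
    rw [hgfun]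
    exact (((contDiff_const.mul contDiff_id).mul hd2).add (contDiff_const.mul (hd1.of_le (by norm_num)))).neg
  have hg1 : Differentiable ℝ g := hgC.differentiable (by norm_num)
  have hvort : (fun z => -(Δ (fun y : EuclideanSpace ℝ (Fin 3) => y 1 * φ (y 0 ^ 2 + y 1 ^ 2))) z) =
      fun z : EuclideanSpace ℝ (Fin 3) => z 1 * g (z 0 ^ 2 + z 1 ^ 2) := by
    funext z; rw [laplacian_dip1 hφ2 z, hg]; ring
  -- hypotheses of `colForceVort_streamField`
  have hΨ : ContDiff ℝ 4 (fun y : EuclideanSpace ℝ (Fin 3) => y 1 * φ (y 0 ^ 2 + y 1 ^ 2)) := contDiff_dip1 hφ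
  have hax : ∀ z, fderiv ℝ (fun y : EuclideanSpace ℝ (Fin 3) => y 1 * φ (y 0 ^ 2 + y 1 ^ 2)) z (EuclideanSpace.single 2 1) = 0 :=
    fderiv_dip1_axis hφ1
  have hon : Orthonormal ℝ ![EuclideanSpace.single (2 : Fin 3) (1 : ℝ), EuclideanSpace.single 0 1, EuclideanSpace.single 1 1] := by
    rw [orthonormal_iff_ite]
    intro i j
    fin_cases i <;> fin_cases j <;> simp [EuclideanSpace.inner_single_left]
  have htr : ⟪B (EuclideanSpace.single 0 1), EuclideanSpace.single (0 : Fin 3) (1 : ℝ)⟫_ℝ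
      + ⟪B (EuclideanSpace.single 1 1), EuclideanSpace.single (1 : Fin 3) (1 : ℝ)⟫_ℝ = 3 / 2 - (3 / 2 + γ) := by
    rw [hB0, hB1, real_inner_smul_left, real_inner_smul_left]
    simp
    ring
  have hdivU : VectorCalculus.IsDivFree (colBase B α γ Rc (EuclideanSpace.single 2 1)) := isDivFree_colBase hon hB2 htr α γ Rc
  rw [colForceVort_streamField hB2 hdivU hΨ hax y, hvort]
  -- the pieces
  have hDw : ∀ v, fderiv ℝ (fun z : EuclideanSpace ℝ (Fin 3) => z 1 * g (z 0 ^ 2 + z 1 ^ 2)) y v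
      = g (y 0 ^ 2 + y 1 ^ 2) * v 1 + y 1 * deriv g (y 0 ^ 2 + y 1 ^ 2) * (2 * y 0 * v 0 + 2 * y 1 * v 1) :=
    fun v => fderiv_dip1_apply (hg1 _).hasDerivAt v
  have hΔw := laplacian_dip1 hgC y
  have hBy := apply_of_diag hB0 hB1 hB2 y
  have hΩ : curlCLM B = 0 := curlCLM_of_diag hB0 hB1 hB2
  have htilt : fderiv ℝ (fun z => cross (gradient (fun y : EuclideanSpace ℝ (Fin 3) => y 1 * φ (y 0 ^ 2 + y 1 ^ 2)) z)
      (EuclideanSpace.single 2 1)) y (curlCLM B + (2 * α) • EuclideanSpace.single 2 1) = 0 := by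
    rw [hΩ, zero_add, map_smul, fderiv_streamField_axis (contDiff_dip1 hφ2) hax y, smul_zero]
  have hW := streamField_dip1 (y := y) (hφ1 _).hasDerivAt
  have hc0 : (cross (EuclideanSpace.single (2 : Fin 3) (1 : ℝ)) y) 0 = -(y 1) := by simp [cross, cross_apply]
  have hc1 : (cross (EuclideanSpace.single (2 : Fin 3) (1 : ℝ)) y) 1 = y 0 := by simp [cross, cross_apply]
  -- swirl transport rotates the pattern: `Dw[S y] = +c(q)·y₀·g(q)`
  have hswirl : fderiv ℝ (fun z : EuclideanSpace ℝ (Fin 3) => z 1 * g (z 0 ^ 2 + z 1 ^ 2)) y (colSwirl γ Rc (EuclideanSpace.single 2 1) y)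
      = (γ * Rc / (8 * Real.pi) * burgersPhi (γ * (y 0 ^ 2 + y 1 ^ 2) / 4)) * y 0 * g (y 0 ^ 2 + y 1 ^ 2) := by
    rw [hDw]
    simp only [colSwirl, PiLp.smul_apply, smul_eq_mul, hc0, hc1, norm_sq_sub_inner_e3_sq]
    ring
  -- Biot–Savart reaction: `⟨y − y₂e₃, W y⟩ = +y₀ φ(q)`
  have hinner : ⟪y - ⟪y, EuclideanSpace.single (2 : Fin 3) (1 : ℝ)⟫_ℝ • EuclideanSpace.single (2 : Fin 3) (1 : ℝ),
      cross (gradient (fun y : EuclideanSpace ℝ (Fin 3) => y 1 * φ (y 0 ^ 2 + y 1 ^ 2)) y) (EuclideanSpace.single 2 1)⟫_ℝ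
        = y 0 * φ (y 0 ^ 2 + y 1 ^ 2) := by
    rw [hW, PiLp.inner_apply]
    simp [Fin.sum_univ_three]
    ring
  -- linear-flow transport: `Dw[B y] = −(γ/2) y₁ g − γ y₁ q g′`
  have hlin : fderiv ℝ (fun z : EuclideanSpace ℝ (Fin 3) => z 1 * g (z 0 ^ 2 + z 1 ^ 2)) y (B y)
      = -(γ / 2) * y 1 * g (y 0 ^ 2 + y 1 ^ 2) - γ * y 1 * (y 0 ^ 2 + y 1 ^ 2) * deriv g (y 0 ^ 2 + y 1 ^ 2) := by
    rw [hDw, hBy]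
    simp
    ring
  rw [hswirl, hinner, htilt, hlin, hΔw, sub_zero, norm_sq_sub_inner_e3_sq, laplacian_dip1 hφ2 y, hg (y 0 ^ 2 + y 1 ^ 2)]
  congr 1
  ring

end Summit.NavierStokesRegularity.NavierStokesRegularity.Theorems.DefectColumnGate

end
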